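import Literature.InformationTheory.QuantumCodes.CSSEquivalence
import Literature.InformationTheory.QuantumCodes.CSSDirectSum
import Literature.InformationTheory.QuantumCodes.AbelianTwoBlockParameters
import HarnessLib

/-!
# Coset decomposition of abelian two-block codes: a pair supported in a subgroup `H ≤ G` gives
# `[G:H]` disjoint copies of the two-block code over `H`

Lin–Pryadko [LinPryadko2024, §4.3]: the rows and columns of `H_X = [A|B]`, `H_Z = [Bᵀ|Aᵀ]` of a
two-block group-algebra code `LP[a,b]` split into blocks labelled by the double cosets `G_a x G_b` of
the support subgroups; if these do not exhaust `G` "the code `LP[a,b]` is decomposed into smaller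
mutually disconnected subcodes", a "direct sum of individual double-coset subcodes", and (Statement 7,
abelian case) "a code equivalent to any double-coset subcode of a 2BGA code `LP[a,b]` over `F[G]` can
be constructed as a 2BGA code over a subgroup of `G`". For an ABELIAN group the double cosets of
`G_a`, `G_b` are the cosets of one subgroup `H ⊇ supp a ∪ supp b`, and the statement becomes the qec
census's symmetry (s4) (census/SYMMETRIES.md: "`H_X` and `H_Z` are block-diagonal for the partition of
the qubits by cosets, `C(A,B) = ⊕_c C_c`, `C_c ≅ C_H(A,B)`; hence `n = r·2|H|`, `k = r·k(C_H)`, and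
`d_X = d_X(C_H)`, `d_Z = d_Z(C_H)`", `r = [G:H]`) by which an imprimitive pair INHERITS the certified
parameters of its primitive root.

This file PROVES it for the tree's `AbelianTwoBlock.css a b : CSSCode G G (G ⊕ G)` (coefficient vectors
`a b : G → 𝔽₂`, any finite abelian `G`, any subgroup `H` containing both supports):

* `cosetEquiv H : ↥H × G ⧸ H ≃ G`, `(h, q) ↦ rep q + h` (a transversal `rep`), and the induced qubit
  bijection `cosetQubitEquiv H : (↥H ⊕ ↥H) × G ⧸ H ≃ G ⊕ G`;
* `HX_eq_submatrix_directSum`, `HZ_eq_submatrix_directSum`: along these bijections `H_X(a,b)`, `H_Z(a,b)`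
  ARE the block-diagonal matrices of `[G:H]` copies of the code over `H` on `(a|_H, b|_H)` — i.e.
  `css a b` is permutation equivalent (`CSSEquivalence.lean`) to `CSSCode.directSum` (`CSSDirectSum.lean`)
  of copies of `css (a|_H) (b|_H)`;
* **`css_dX_eq_restrict`, `css_dZ_eq_restrict` : `d^X`, `d^Z` are those of the code over `H`**;
  **`css_k_eq_index_mul` : `k = [G:H] · k_H`**; the qubit count `2|G| = [G:H] · 2|H|`;
* the bivariate-bicycle phrasing `BB.Code.dX_eq_restrict` etc. (`G = ℤ_ℓ × ℤ_m`).

No named facts. (For the census: combine with `TwoBlockCodeEquivalences.css_mapEquiv_*` to move the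
`H`-code to its canonical presentation `ℤ_{a'} × ℤ_{b'}`.)

## References (locators read on the page)

* [LinPryadko2024] H.-K. Lin, L. P. Pryadko, *Quantum two-block group algebra codes*, PRA 109 (2024)
  022407 = arXiv:2306.16400: §4.3 (held text chunk p0009 L99–end, p0010 L1–13: block structure by double
  cosets, "decomposed into smaller mutually disconnected subcodes"; p0010 L14–36: `A = A₁ ⊗ I_{m_a}`,
  "decomposition of the 2BGA code into a direct sum of individual double-coset subcodes"; Statement 7 and
  the abelian remark, p0010 L44–55); App. proof of Statement 7 (chunk p0018 L54–60).
* [CalderbankEtAl1998] Calderbank–Rains–Shor–Sloane, IEEE Trans. IT 44 (1998) 1369 = arXiv:quant-ph/9608006,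
  §4 (chunk p0013 L24–27: direct sum of quantum codes, `[[n+n′, k+k′, min{d,d′}]]`).
-/

namespace Literature.InformationTheory.QuantumCodes

open Matrix

namespace AbelianTwoBlock

variable {G : Type*} [AddCommGroup G] (H : AddSubgroup G)

/-! ### A transversal and the coset bijection `↥H × G ⧸ H ≃ G` -/

/-- A representative of each coset of `H` (a transversal; `rep q ∈ q`).
[cite: LinPryadko2024, §4.3 "x ∈ 𝒜, a transversal set of elements from G_a\\G" (arXiv:2306.16400 chunk p0010 L18–20)] -/
noncomputable def rep (q : G ⧸ H) : G := Quotient.out q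

/-- `rep q` lies in the coset `q`. [cite: LinPryadko2024, §4.3 (arXiv:2306.16400 chunk p0010 L18–20)] -/
@[simp] theorem mk_rep (q : G ⧸ H) : (QuotientAddGroup.mk (rep H q) : G ⧸ H) = q :=
  QuotientAddGroup.out_eq' q

/-- `g − rep [g] ∈ H`. [cite: LinPryadko2024, §4.3 (arXiv:2306.16400 chunk p0010 L18–20)] -/
theorem sub_rep_mem (g : G) : g - rep H (QuotientAddGroup.mk g) ∈ H := by
  have h : (QuotientAddGroup.mk (rep H (QuotientAddGroup.mk g)) : G ⧸ H) = QuotientAddGroup.mk g :=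
    mk_rep H _
  rw [QuotientAddGroup.eq] at h
  -- h : -rep + g ∈ H
  simpa [sub_eq_add_neg, add_comm] using h

/-- Two representatives differ by an element of `H` only if the cosets coincide.
[cite: LinPryadko2024, §4.3 (arXiv:2306.16400 chunk p0010 L18–20)] -/
theorem rep_sub_rep_mem_iff (q q' : G ⧸ H) : rep H q - rep H q' ∈ H ↔ q = q' := by
  constructor
  · intro h
    rw [← mk_rep H q, ← mk_rep H q', QuotientAddGroup.eq]
    have : -rep H q + rep H q' = -(rep H q - rep H q') := by abel
    rw [this]
    exact H.neg_mem h
  · rintro rfl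
    simp

/-- **The coset bijection** `↥H × G ⧸ H ≃ G`, `(h, q) ↦ rep q + h` (ordering the group "so that elements
of the subgroup go first, followed by elements of each coset, with elements of the subgroup taken in the
same order"). [cite: LinPryadko2024, §4.3 (arXiv:2306.16400 chunk p0010 L14–22)] -/
noncomputable def cosetEquiv : ↥H × G ⧸ H ≃ G where
  toFun p := rep H p.2 + p.1
  invFun g := (⟨g - rep H (QuotientAddGroup.mk g), sub_rep_mem H g⟩, QuotientAddGroup.mk g)
  left_inv := by
    rintro ⟨⟨h, hh⟩, q⟩
    have hq : (QuotientAddGroup.mk (rep H q + h) : G ⧸ H) = q := by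
      conv_rhs => rw [← mk_rep H q]
      rw [QuotientAddGroup.eq]
      simpa using H.neg_mem hh
    ext
    · simp [hq]
    · exact hq
  right_inv g := by simp

/-- `cosetEquiv H (h, q) = rep q + h`. [cite: LinPryadko2024, §4.3 (arXiv:2306.16400 chunk p0010 L14–22)] -/
theorem cosetEquiv_apply (h : ↥H) (q : G ⧸ H) : cosetEquiv H (h, q) = rep H q + h := rfl

/-- Differences inside one coset are differences in `H`; across cosets they leave `H`: for a function
`a` supported in `H`, `a (rep q + h − (rep q' + h')) = [q = q'] · a (h − h')`.
[cite: LinPryadko2024, §4.3 "the m_a blocks of the matrix A associated with different cosets are identical, A = A₁ ⊗ I" (arXiv:2306.16400 chunk p0010 L20–24)] -/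
theorem apply_cosetEquiv_sub_cosetEquiv {a : G → ZMod 2} (ha : ∀ g, g ∉ H → a g = 0) (h h' : ↥H)
    (q q' : G ⧸ H) [Decidable (q = q')] :
    a (cosetEquiv H (h, q) - cosetEquiv H (h', q')) = if q = q' then a ((h : G) - h') else 0 := by
  by_cases hq : q = q'
  · subst hq
    rw [if_pos rfl]
    congr 1
    simp only [cosetEquiv_apply]
    abel
  · rw [if_neg hq]
    apply ha
    intro hmem
    apply hq
    rw [← rep_sub_rep_mem_iff H]
    have : rep H q - rep H q' = (cosetEquiv H (h, q) - cosetEquiv H (h', q')) - ((h : G) - h') := by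
      simp only [cosetEquiv_apply]; abel
    rw [this]
    exact H.sub_mem hmem (H.sub_mem h.2 h'.2)

/-- The induced qubit bijection `(↥H ⊕ ↥H) × G ⧸ H ≃ G ⊕ G` (both blocks decomposed by the same cosets).
[cite: LinPryadko2024, §4.3 (arXiv:2306.16400 chunk p0010 L14–36)] -/
noncomputable def cosetQubitEquiv : (↥H ⊕ ↥H) × G ⧸ H ≃ G ⊕ G :=
  (Equiv.sumProdDistrib _ _ _).trans (Equiv.sumCongr (cosetEquiv H) (cosetEquiv H))

/-- `cosetQubitEquiv (L h, q) = L (rep q + h)`. [cite: LinPryadko2024, §4.3 (arXiv:2306.16400 chunk p0010 L14–36)] -/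
@[simp] theorem cosetQubitEquiv_inl (h : ↥H) (q : G ⧸ H) :
    cosetQubitEquiv H (Sum.inl h, q) = Sum.inl (cosetEquiv H (h, q)) := by
  simp [cosetQubitEquiv]

/-- `cosetQubitEquiv (R h, q) = R (rep q + h)`. [cite: LinPryadko2024, §4.3 (arXiv:2306.16400 chunk p0010 L14–36)] -/
@[simp] theorem cosetQubitEquiv_inr (h : ↥H) (q : G ⧸ H) :
    cosetQubitEquiv H (Sum.inr h, q) = Sum.inr (cosetEquiv H (h, q)) := by
  simp [cosetQubitEquiv]

/-! ### The check matrices are block diagonal along the cosets -/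

section Blocks

variable [Fintype G] [DecidablePred (· ∈ H)] [Fintype (G ⧸ H)] [DecidableEq (G ⧸ H)]
variable {a b : G → ZMod 2} (ha : ∀ g, g ∉ H → a g = 0) (hb : ∀ g, g ∉ H → b g = 0)

/-- The restriction `a|_H` of a coefficient vector to the subgroup.
[cite: LinPryadko2024, §4.3 "A₁ ≡ L_{G_a}(a) … row and column indices are restricted to" the subgroup (arXiv:2306.16400 chunk p0010 L22–24)] -/
def restrict (a : G → ZMod 2) : ↥H → ZMod 2 := fun h => a h

omit [Fintype G] [DecidablePred (· ∈ H)] [Fintype (G ⧸ H)] [DecidableEq (G ⧸ H)] in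
/-- `restrict H a h = a h`. [cite: LinPryadko2024, §4.3 (arXiv:2306.16400 chunk p0010 L22–24)] -/
@[simp] theorem restrict_apply (a : G → ZMod 2) (h : ↥H) : restrict H a h = a h := rfl

include ha hb in
omit [Fintype G] [DecidablePred (· ∈ H)] [Fintype (G ⧸ H)] in
/-- **`H_X(a,b)` re-indexed by cosets is block diagonal** with `[G:H]` identical blocks `H_X(a|_H, b|_H)`.
[cite: LinPryadko2024, §4.3 "A = A₁ ⊗ I_{m_a}" and "decomposition … into a direct sum" (arXiv:2306.16400 chunk p0010 L20–36)] -/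
theorem HX_submatrix_cosetEquiv :
    (HX a b).submatrix (cosetEquiv H) (cosetQubitEquiv H) =
      blockDiagonal fun _ : G ⧸ H => HX (restrict H a) (restrict H b) := by
  ext ⟨h, q⟩ ⟨j, q'⟩
  rcases j with h' | h'
  · rw [submatrix_apply, blockDiagonal_apply]
    simp only [HX, fromCols_apply_inl, circulant_apply, restrict_apply, cosetQubitEquiv_inl,
      AddSubgroupClass.coe_sub]
    rw [apply_cosetEquiv_sub_cosetEquiv H ha]
  · rw [submatrix_apply, blockDiagonal_apply]
    simp only [HX, fromCols_apply_inr, circulant_apply, restrict_apply, cosetQubitEquiv_inr,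
      AddSubgroupClass.coe_sub]
    rw [apply_cosetEquiv_sub_cosetEquiv H hb]

include ha hb in
omit [Fintype G] [DecidablePred (· ∈ H)] [Fintype (G ⧸ H)] in
/-- **`H_Z(a,b)` re-indexed by cosets is block diagonal** with blocks `H_Z(a|_H, b|_H)`.
[cite: LinPryadko2024, §4.3 "the same is true for the x-th row of matrix H_Z" (arXiv:2306.16400 chunk p0010 L4–6, L20–36)] -/
theorem HZ_submatrix_cosetEquiv :
    (HZ a b).submatrix (cosetEquiv H) (cosetQubitEquiv H) =
      blockDiagonal fun _ : G ⧸ H => HZ (restrict H a) (restrict H b) := by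
  ext ⟨h, q⟩ ⟨j, q'⟩
  rcases j with h' | h'
  · rw [submatrix_apply, blockDiagonal_apply]
    simp only [HZ, fromCols_apply_inl, transpose_apply, circulant_apply, restrict_apply,
      cosetQubitEquiv_inl, AddSubgroupClass.coe_sub]
    rw [apply_cosetEquiv_sub_cosetEquiv H hb]
    by_cases hq : q = q'
    · subst hq; simp
    · rw [if_neg (Ne.symm hq), if_neg hq]
  · rw [submatrix_apply, blockDiagonal_apply]
    simp only [HZ, fromCols_apply_inr, transpose_apply, circulant_apply, restrict_apply,
      cosetQubitEquiv_inr, AddSubgroupClass.coe_sub]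
    rw [apply_cosetEquiv_sub_cosetEquiv H ha]
    by_cases hq : q = q'
    · subst hq; simp
    · rw [if_neg (Ne.symm hq), if_neg hq]

include ha hb in
omit [DecidablePred (· ∈ H)] in
/-- `H_X(a,b)` IS, up to the coset bijections, the `X`-check matrix of the direct sum of `[G:H]` copies of
`css (a|_H) (b|_H)`. [cite: LinPryadko2024, §4.3 (arXiv:2306.16400 chunk p0010 L20–36)] -/
theorem HX_eq_submatrix_directSum [Fintype ↥H] :
    (css a b).HX = (CSSCode.directSum fun _ : G ⧸ H => css (restrict H a) (restrict H b)).HX.submatrix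
      (cosetEquiv H).symm (cosetQubitEquiv H).symm := by
  rw [CSSCode.directSum_HX]
  simp only [css_HX]
  rw [← HX_submatrix_cosetEquiv H ha hb, submatrix_submatrix]
  simp

include ha hb in
omit [DecidablePred (· ∈ H)] in
/-- `H_Z(a,b)` likewise. [cite: LinPryadko2024, §4.3 (arXiv:2306.16400 chunk p0010 L20–36)] -/
theorem HZ_eq_submatrix_directSum [Fintype ↥H] :
    (css a b).HZ = (CSSCode.directSum fun _ : G ⧸ H => css (restrict H a) (restrict H b)).HZ.submatrix
      (cosetEquiv H).symm (cosetQubitEquiv H).symm := by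
  rw [CSSCode.directSum_HZ]
  simp only [css_HZ]
  rw [← HZ_submatrix_cosetEquiv H ha hb, submatrix_submatrix]
  simp

end Blocks

/-! ### (s4): the parameters are inherited from the code over `H` -/

section Inherit

variable [Fintype G] [DecidablePred (· ∈ H)]
variable {a b : G → ZMod 2} (ha : ∀ g, g ∉ H → a g = 0) (hb : ∀ g, g ∉ H → b g = 0)

include ha hb in
/-- **(s4) `d^X` is inherited**: if `supp a ∪ supp b ⊆ H` then `d^X(css a b) = d^X(css a|_H b|_H)` (the
code is `[G:H]` disjoint copies of the code over `H`; junk value `0` on both sides when `k = 0`).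
[cite: LinPryadko2024, §4.3 and Statement 7 (abelian case) (arXiv:2306.16400 chunk p0010 L1–55)]
[cite: CalderbankEtAl1998, §4 "d″ = min{d, d′}" (arXiv:quant-ph/9608006 chunk p0013 L26)] -/
theorem css_dX_eq_restrict : (css a b).dX = (css (restrict H a) (restrict H b)).dX := by
  classical
  rw [CSSCode.dX_eq_of_submatrix (HX_eq_submatrix_directSum H ha hb) (HZ_eq_submatrix_directSum H ha hb),
    CSSCode.directSum_const_dX]

include ha hb in
/-- **(s4) `d^Z` is inherited**: `d^Z(css a b) = d^Z(css a|_H b|_H)`.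
[cite: LinPryadko2024, §4.3 and Statement 7 (abelian case) (arXiv:2306.16400 chunk p0010 L1–55)]
[cite: CalderbankEtAl1998, §4 "d″ = min{d, d′}" (arXiv:quant-ph/9608006 chunk p0013 L26)] -/
theorem css_dZ_eq_restrict : (css a b).dZ = (css (restrict H a) (restrict H b)).dZ := by
  classical
  rw [CSSCode.dZ_eq_of_submatrix (HX_eq_submatrix_directSum H ha hb) (HZ_eq_submatrix_directSum H ha hb),
    CSSCode.directSum_const_dZ]

include ha hb in
/-- **(s4) `k = [G:H] · k_H`**. [cite: LinPryadko2024, §4.3 (direct sum of the coset subcodes) (arXiv:2306.16400 chunk p0010 L34–36)]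
[cite: CalderbankEtAl1998, §4 "an [[n + n′, k + k′, d″]] code" (arXiv:quant-ph/9608006 chunk p0013 L26)] -/
theorem css_k_eq_index_mul : (css a b).k = H.index * (css (restrict H a) (restrict H b)).k := by
  classical
  rw [CSSCode.k_eq_of_submatrix (HX_eq_submatrix_directSum H ha hb) (HZ_eq_submatrix_directSum H ha hb),
    CSSCode.directSum_const_k, AddSubgroup.index, Nat.card_eq_fintype_card]

omit [DecidablePred (· ∈ H)] in
/-- The qubit count splits accordingly: `2|G| = [G:H] · 2|H|`.
[cite: LinPryadko2024, §4.3 (arXiv:2306.16400 chunk p0010 L14–22)] -/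
theorem card_qubits_eq_index_mul [Fintype ↥H] :
    Fintype.card (G ⊕ G) = H.index * Fintype.card (↥H ⊕ ↥H) := by
  classical
  rw [AddSubgroup.index, Nat.card_eq_fintype_card, mul_comm, ← Fintype.card_prod]
  exact (Fintype.card_congr (cosetQubitEquiv H)).symm

include ha hb in
/-- In particular `k > 0` over `G` iff `k > 0` over `H` (so the two distance equalities are never an
artefact of the junk value on one side only). [cite: LinPryadko2024, §4.3 (arXiv:2306.16400 chunk p0010 L34–36)] -/
theorem css_k_pos_iff_restrict : 0 < (css a b).k ↔ 0 < (css (restrict H a) (restrict H b)).k := by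
  rw [css_k_eq_index_mul H ha hb]
  have hi : 0 < H.index := Nat.pos_of_ne_zero H.index_ne_zero_of_finite
  constructor
  · intro h
    by_contra h0
    have hk : (css (restrict H a) (restrict H b)).k = 0 := by omega
    rw [hk, mul_zero] at h
    exact lt_irrefl 0 h
  · intro h
    exact Nat.mul_pos hi h

end Inherit

end AbelianTwoBlock

/-! ### Bivariate-bicycle phrasing (`G = ℤ_ℓ × ℤ_m`) -/

namespace BB.Code

variable {ℓ m : ℕ} [NeZero ℓ] [NeZero m] (C : Code ℓ m) (H : AddSubgroup (Mono ℓ m)) [DecidablePred (· ∈ H)]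

/-- **(s4) for BB codes, `d^X`**: if every exponent of `A` and of `B` lies in a subgroup `H` of
`ℤ_ℓ × ℤ_m` (after the (s1) translations putting `0 ∈ A, 0 ∈ B`: `H = ⟨A ∪ B⟩`), then `d^X(QC(A,B))` is the
`d^X` of the two-block code over `H` on the restricted coefficient vectors.
[cite: LinPryadko2024, §4.3 and Statement 7 (abelian case) (arXiv:2306.16400 chunk p0010 L1–55)] -/
theorem dX_eq_restrict (hA : ∀ g, g ∉ H → C.A g = 0) (hB : ∀ g, g ∉ H → C.B g = 0) :
    C.css.dX = (AbelianTwoBlock.css (AbelianTwoBlock.restrict H (coeffVec C.A))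
      (AbelianTwoBlock.restrict H (coeffVec C.B))).dX := by
  rw [css_eq]
  exact AbelianTwoBlock.css_dX_eq_restrict H (fun g hg => hA (-g) (fun h => hg (by simpa using H.neg_mem h)))
    (fun g hg => hB (-g) (fun h => hg (by simpa using H.neg_mem h)))

/-- (s4) for BB codes, `d^Z`. [cite: LinPryadko2024, §4.3 and Statement 7 (abelian case) (arXiv:2306.16400 chunk p0010 L1–55)] -/
theorem dZ_eq_restrict (hA : ∀ g, g ∉ H → C.A g = 0) (hB : ∀ g, g ∉ H → C.B g = 0) :
    C.css.dZ = (AbelianTwoBlock.css (AbelianTwoBlock.restrict H (coeffVec C.A))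
      (AbelianTwoBlock.restrict H (coeffVec C.B))).dZ := by
  rw [css_eq]
  exact AbelianTwoBlock.css_dZ_eq_restrict H (fun g hg => hA (-g) (fun h => hg (by simpa using H.neg_mem h)))
    (fun g hg => hB (-g) (fun h => hg (by simpa using H.neg_mem h)))

/-- (s4) for BB codes, `k = [ℤ_ℓ×ℤ_m : H] · k_H`. [cite: LinPryadko2024, §4.3 (arXiv:2306.16400 chunk p0010 L34–36)] -/
theorem k_eq_index_mul (hA : ∀ g, g ∉ H → C.A g = 0) (hB : ∀ g, g ∉ H → C.B g = 0) :
    C.k = H.index * (AbelianTwoBlock.css (AbelianTwoBlock.restrict H (coeffVec C.A))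
      (AbelianTwoBlock.restrict H (coeffVec C.B))).k := by
  rw [k, css_eq]
  exact AbelianTwoBlock.css_k_eq_index_mul H (fun g hg => hA (-g) (fun h => hg (by simpa using H.neg_mem h)))
    (fun g hg => hB (-g) (fun h => hg (by simpa using H.neg_mem h)))

end BB.Code

end Literature.InformationTheory.QuantumCodes
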